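import Summits.CriticalPhenomena.PercolationContinuityZ3.Theorems.PercNearOneGluingNoHeavyLowerTailAntitheticHandleDual
import Summits.CriticalPhenomena.PercolationContinuityZ3.Theorems.PercNearOneGluingNoHeavyLowerTailAntitheticTransport
import Summits.CriticalPhenomena.PercolationContinuityZ3.Theorems.PercNearOneGluingNoHeavyLowerTailAntitheticW4Oplus
import Summits.CriticalPhenomena.PercolationContinuityZ3.Theorems.PercNearOneGluingNoHeavyLowerTailAntitheticApexMixed
import HarnessLib

/-!
# `NoHeavyLowerTail` (stmt-CriticalPhenomena-4575) — antithetic cluster pairs: **THEOREM W4H — the WHEEL `W₄` SEEN FROM ITS HUB PLUS A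
# HANDLE BETWEEN OPPOSITE RIM VERTICES** (CONJECTURE Δ2 / the vertex antithetic inequality at `R = {x}`, all arm lengths; prim-hp-2 gen 64,
# HOME/MEMO-gen64.md §3)

Support file (`--supports stmt-CriticalPhenomena-4575`, hull-port prover `prim-hp-2`, gen 64).  No definitions, no named facts, no sorries;
the ⊕-input …AntitheticW4Oplus (gen 59) is a `native_decide`-checked certificate.  VERTEX version.

THE GRAPH.  `W₄ = c 0 * (c 1 c 2 c 3 c 4 c 1)` (`c : Fin 5 → V` injective; edge set `E₀ = Sym2.map c '' {01,02,03,04,12,23,34,14}`), source the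
hub `s = c 0`, handle `P = c 1 – u 1 … u a = y – x – z = w b … w 1 – Q = c 3` between OPPOSITE rim vertices (arms of fresh vertices, `a, b ≥ 0`,
`x` fresh, `yz ∉ H`).  `λ(s, P) = λ(s, Q) = 3`: neither `{P ∈ X_{W₄}}` nor `{Q ∈ X_{W₄}}` is box-decomposable (HOME/MEMO-gen62.md §1(b)), so
no box theorem reaches this family;
* `Antithetic.W4.handle_vertex_sum_nonneg` — **THEOREM W4H**: for all monotone `F, G`,
  `0 ≤ Σ_{ω : ¬(x ∈ X_E ω ∧ x ∈ Y_E ω)} (F(X_E ω) − F(Y_E ω))·(G(X_E ω) − G(Y_E ω))`, `E = W₄ ∪ arms + xy + xz`.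
PROOF = DUAL HANDLE THEOREM (…AntitheticHandleDual) with (⊕) = `Antithetic.W4.oplus_powerset` (checked certificate on `Fin 5`, gen 59)
transported along `c` (`Antithetic.Transport.oplus_of_powerset`) and (M) = `Antithetic.Apex.mixed_nonneg_near` (`Q = c 3` is joined to
`c 2, c 4` — every vertex other than `s, P, Q` — and to `s`).
[cite: VandenbergHaggstromKahn2005, §1 p. 6 ("Harris' inequality"), §1 p. 3 (open cluster `C_s`)]
-/

noncomputable section

namespace Summit.CriticalPhenomena.PercolationContinuityZ3.Theorems

open Literature.Probability.Percolation
open scoped Classical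

namespace Antithetic

namespace W4

variable {V : Type*} {c : Fin 5 → V} (hc : Function.Injective c) {E₀ : Set (Sym2 V)}
  (hE₀ : E₀ = Sym2.map c '' ↑({s(0, 1), s(0, 2), s(0, 3), s(0, 4), s(1, 2), s(2, 3), s(3, 4), s(1, 4)} : Finset (Sym2 (Fin 5))))
include hc hE₀

omit hc in
/-- The rim vertex `c 3` is a near-apex for `(W₄, c 0, c 1)`: joined to every vertex other than `c 0, c 1, c 3`. [this work] -/
theorem near_apex : ∀ e ∈ E₀, ∀ v ∈ e, v ≠ c 3 → v ≠ c 0 → v ≠ c 1 → s(v, c 3) ∈ E₀ := by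
  have hK : ∀ k : Fin 5, k ≠ 3 → k ≠ 0 → k ≠ 1 →
      s(k, 3) ∈ ({s(0, 1), s(0, 2), s(0, 3), s(0, 4), s(1, 2), s(2, 3), s(3, 4), s(1, 4)} : Finset (Sym2 (Fin 5))) := by decide
  rw [hE₀]
  rintro f ⟨e, he, rfl⟩ v hv hv3 hv0 hv1
  induction e using Sym2.ind with
  | h i j =>
    rw [Sym2.map_mk] at hv
    have hv' : ∃ k, v = c k := by
      rcases Sym2.mem_iff.1 hv with rfl | rfl
      · exact ⟨i, rfl⟩
      · exact ⟨j, rfl⟩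
    obtain ⟨k, rfl⟩ := hv'
    exact ⟨s(k, 3), Finset.mem_coe.2 (hK k (fun h => hv3 (by rw [h])) (fun h => hv0 (by rw [h])) (fun h => hv1 (by rw [h]))),
      Sym2.map_mk _ _ _⟩

omit hc in
/-- The spoke `c 0 c 3` is a pair of `W₄`. [this work] -/
theorem spoke_mem : s(c 0, c 3) ∈ E₀ := by
  rw [hE₀]
  exact ⟨s(0, 3), Finset.mem_coe.2 (by decide), Sym2.map_mk _ _ _⟩

variable [Fintype V] {u w : ℕ → V} {a b : ℕ}
  (hu0 : u 0 = c 1) (hw0 : w 0 = c 3)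
  (hufresh : ∀ i, 0 < i → i ≤ a → ∀ f ∈ E₀ ∪ Cyc.edgeSet b w, u i ∈ f → f.IsDiag)
  (hwfresh : ∀ i, 0 < i → i ≤ b → ∀ f ∈ E₀, w i ∈ f → f.IsDiag)
  (huinj : ∀ i j, i ≤ a → j ≤ a → u i = u j → i = j) (hwinj : ∀ i j, i ≤ b → j ≤ b → w i = w j → i = j)
  (hsu : ∀ i, 0 < i → i ≤ a → c 0 ≠ u i) (hsw : ∀ i, 0 < i → i ≤ b → c 0 ≠ w i)
  (hPw : ∀ i, 0 < i → i ≤ b → c 1 ≠ w i) (hzu : ∀ i, 0 < i → i ≤ a → w b ≠ u i)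
include hu0 hw0 hufresh hwfresh huinj hwinj hsu hsw hPw hzu

/-- **THEOREM W4H (`W₄` from the hub + handle between opposite rim vertices, all arm lengths).**  With the notation of the module
docstring (`s = c 0`, `P = c 1`, `Q = c 3`), for all monotone `F, G`:
`0 ≤ Σ_{ω : ¬(x ∈ X_E ω ∧ x ∈ Y_E ω)} (F(X_E ω) − F(Y_E ω))·(G(X_E ω) − G(Y_E ω))`, `E = (arm ∪ (stub ∪ E₀)) + xz + xy` (the two pairs at
`x` are listed in the order `xz, xy`; the statement is about the wheel, not a restatement of …AntitheticK4Handle). [this work] -/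
theorem handle_vertex_sum_nonneg {x : V}
    (hx : ∀ f ∈ Cyc.edgeSet a u ∪ (Cyc.edgeSet b w ∪ E₀), x ∈ f → f.IsDiag)
    (hxs : x ≠ c 0) (hxy : x ≠ u a) (hxz : x ≠ w b) (hyz : u a ≠ w b) (hg : s(u a, w b) ∉ Cyc.edgeSet a u ∪ (Cyc.edgeSet b w ∪ E₀))
    {F G : Set V → ℝ} (hF : Monotone F) (hG : Monotone G) :
    0 ≤ ∑ ω ∈ Finset.univ.filter (fun ω : Set (Sym2 V) =>
        ¬ ((openGraph (ω ∩ insert s(x, w b) (insert s(x, u a) (Cyc.edgeSet a u ∪ (Cyc.edgeSet b w ∪ E₀))))).Reachable (c 0) x ∧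
          (openGraph (ωᶜ ∩ insert s(x, w b) (insert s(x, u a) (Cyc.edgeSet a u ∪ (Cyc.edgeSet b w ∪ E₀))))).Reachable (c 0) x)),
      (F (openCluster (ω ∩ insert s(x, w b) (insert s(x, u a) (Cyc.edgeSet a u ∪ (Cyc.edgeSet b w ∪ E₀)))) (c 0)) -
          F (openCluster (ωᶜ ∩ insert s(x, w b) (insert s(x, u a) (Cyc.edgeSet a u ∪ (Cyc.edgeSet b w ∪ E₀)))) (c 0))) *
        (G (openCluster (ω ∩ insert s(x, w b) (insert s(x, u a) (Cyc.edgeSet a u ∪ (Cyc.edgeSet b w ∪ E₀)))) (c 0)) -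
          G (openCluster (ωᶜ ∩ insert s(x, w b) (insert s(x, u a) (Cyc.edgeSet a u ∪ (Cyc.edgeSet b w ∪ E₀)))) (c 0))) := by
  have hcomm : Cyc.edgeSet b w ∪ E₀ = E₀ ∪ Cyc.edgeSet b w := Set.union_comm _ _
  rw [hcomm] at hx hg ⊢
  rw [Set.insert_comm]
  -- no loops in the image edge set
  have hK : ∀ e ∈ ({s(0, 1), s(0, 2), s(0, 3), s(0, 4), s(1, 2), s(2, 3), s(3, 4), s(1, 4)} : Finset (Sym2 (Fin 5))), ¬ e.IsDiag := by
    decide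
  have hnd : ∀ f ∈ E₀, ¬ f.IsDiag := by
    rw [hE₀]
    rintro f ⟨e, he, rfl⟩
    have hne := hK e (Finset.mem_coe.1 he)
    induction e using Sym2.ind with
    | h i j =>
      rw [Sym2.map_mk, Sym2.mk_isDiag_iff]
      rw [Sym2.mk_isDiag_iff] at hne
      exact fun h => hne (hc h)
  -- (⊕): the checked certificate on `Fin 5`, transported along `c` (instances identified by `convert`, as in …AntitheticK4Handle)
  have hop := fun (K₁ K₂ : Set V → Set V → ℝ) hK₁ hso₁ hK₂ hso₂ =>
    Transport.oplus_of_powerset hc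
      ({s(0, 1), s(0, 2), s(0, 3), s(0, 4), s(1, 2), s(2, 3), s(3, 4), s(1, 4)} : Finset (Sym2 (Fin 5))) 0 1
      (fun L₁ L₂ hL₁ hsoL₁ hL₂ hsoL₂ => by
        convert oplus_powerset L₁ L₂ hL₁ hsoL₁ hL₂ hsoL₂ using 9)
      hE₀ K₁ K₂ hK₁ hso₁ hK₂ hso₂
  -- (M): `c 3` is a near-apex joined to the hub
  have hmix := fun (K₁ K₂ : Set V → Set V → ℝ) hK₁ hso₁ hK₂ hso₂ =>
    Apex.mixed_nonneg_near (E := E₀) (s := c 0) (P := c 1) (near_apex hE₀) (spoke_mem hE₀)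
      (fun h => absurd (hc h) (by decide)) K₁ K₂ hK₁ hso₁ hK₂ hso₂
  have h := Pendant.handle_vertex_sum_nonneg_of_oplus hnd hwfresh hwinj hsw hPw hop hu0 hw0 hufresh huinj hsu hzu hmix
    hx hxs hxy hxz hyz hg hF hG
  convert h using 3

end W4

end Antithetic

end Summit.CriticalPhenomena.PercolationContinuityZ3.Theorems
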